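import Literature.NumberTheory.EllipticCurves.KohelShparlinskiCharacterSumsSubgroupProofs
import Literature.NumberTheory.EllipticCurves.WeierstrassRationalPlaces
import Literature.NumberTheory.DiophantineGeometry.FunctionFieldRayClassLSeriesEuler
import Mathlib.Analysis.Normed.Ring.Finite
import HarnessLib

/-!
# Kohel–Shparlinski character sums: reduction of the named fact to ray class `L`-series data
(the "Weil bound" step, [KohelShparlinski2000, Props. 1–2 ⇒ Thm. 1 ⇒ (3)])

Third proof file towards the discharge of the named fact
`Literature.NumberTheory.EllipticCurves.KohelShparlinski.CoordinateCharSumBound`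
(`KohelShparlinskiCharacterSums`; the first, `…SubgroupProofs`, reduces Cor. 1 to the full-group
inequality (3)). This file isolates the ANALYTIC half of the source's proof of Theorem 1 and puts
the named fact in the form in which the arithmetic half (the covering `LangASCover`, its Frobenius
elements and reciprocity law) has to deliver it.

* `AlgFunctionField.placePowerSum_one` — `S₁(χ) = Σ_{deg v = 1, v ≠ P} χ(v)`.
* **`AlgFunctionField.norm_placePowerSum_one_le_of_family`** — *the Weil bound for a member of a
  family of nontrivial ray class characters* of a function field `F/𝔽_q` (full constant field
  `𝔽_q`), modulus `N·P`: if every `χᵢ` (`i ∈ s`) kills the divisors of the ray functions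
  `h ≡ 1 (mod 𝔪_P^N)` and is `≠ 1` on some divisor of degree `0` prime to `P` — so that
  `L(χᵢ, t)` is a polynomial of degree `≤ 2g - 2 + N deg P` ([KohelShparlinski2000, Prop. 1] =
  the tree's `AddChar.exists_polynomial_eq_rayClassLSeries`) — and the family satisfies the orbit
  bound `‖Σ_{i ∈ s} S_r(χᵢ)‖ ≤ C q^{r/2}` for all `r ≥ 1` (which is how the Riemann hypothesis for
  the covering curve, [KohelShparlinski2000, Prop. 2], is fed in), then every inverse root of every
  `L(χᵢ, t)` has absolute value `≤ √q` (the tree's `norm_inv_le_of_logDeriv_bound`) and hence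
  `|S₁(χᵢ)| ≤ (2g - 2 + N deg P) √q` (`norm_coeff_one_le_of_roots`) — the inequality
  `|S(ω, ψ, f)| ≤ deg 𝔣 · q^{1/2}` in the proof of [KohelShparlinski2000, Thm. 1, p. 398].
* `affineTerm`, **`affineCharSum_top_eq_finsum`** — the source's sum `S(ω, ψ, f)` over the affine
  points, written in the named fact as a `dite`-sum over `𝔽_q × 𝔽_q`, equals the `finsum` over
  Mathlib's `W.toAffine.Point`; **`placePowerSum_infPlace_one_eq_finsum`** — for the elliptic
  function field `k(W)`, `S₁(χ) = Σ_{P ∈ W(k), P ≠ O} χ(placeOfPoint P)` (rational places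
  `= W(k)`, the tree's `WeierstrassRationalPlaces.pointEquivRatPlaces`).
* **`norm_affineCharSum_le_of_family`** — for `W/𝔽_q` elliptic (`g = 1`, `deg ∞ = 1`, so
  `2g - 2 + N deg ∞ = N`): if a character `χ` of `Div(𝔽_q(W))` in such a family (modulus `N·∞`)
  takes the values `χ(placeOfPoint (a, b)) = ω((a, b)) ψ(f a b)`, then `|S(ω, ψ, f)| ≤ N √q`.
* **`coordinateCharSumBound_of_families`** — the named fact follows from the existence of such
  families with `N = 3` for `f = x` (`p ≠ 2`; then `3√q ≤ 4√q`) and `N = 4` for `f = y`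
  (`p ≠ 3`; `4√q ≤ 6√q`), for every nontrivial `ψ` and every `ω` — [KohelShparlinski2000, Thm. 1]
  with conductor `𝔣 = (deg f + 1)·O` — combined with `coordinateCharSumBound_of_top`.

Everything is proved; no definitions beyond the bookkeeping function `affineTerm`; no named facts.
The hypotheses of `coordinateCharSumBound_of_families` are exactly what the arithmetic files of
this series (`LangTorsor*`, `LangArtinSchreierCover`, `WeierstrassDivisorClassPoints`, …)
construct: `χ = (ω ∘ pointOfDivisor) · (ψ ∘ Tr ∘ x)`, the family of all `(ω', ψ^c) ≠ (1, 1)`,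
and the orbit bound from `hasseWeil_holds` for `LangASCover` and for `k(W)`.

## References

* D. R. Kohel, I. E. Shparlinski, *On exponential sums and group generators for elliptic curves
  over finite fields*, ANTS-IV, LNCS 1838 (2000), 395–404: Prop. 1, Prop. 2, Thm. 1 and its proof
  (p. 398), inequality (3) (p. 399). [KohelShparlinski2000]
* M. Rosen, *Number Theory in Function Fields*, GTM 210, Ch. 9. [RosenFunctionFields2002]
-/

noncomputable section

open scoped Classical

/-! ### The Weil bound for a member of a family of nontrivial ray class characters -/

namespace Literature.NumberTheory.DiophantineGeometry.AlgFunctionField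

universe u v

variable {K : Type u} {F : Type v} [Field K] [Field F] [Algebra K F]

/-- `S₁(χ) = Σ_{v ≠ P, deg v = 1} χ(v)`: at `r = 1` only the rational places contribute to the place
power sum, each with weight `deg v = 1`. [cite: RosenFunctionFields2002, Ch. 9] -/
theorem placePowerSum_one (P : PlaceOver K F) (χ : AddChar (Divisor K F) ℂ) :
    placePowerSum P χ 1 =
      ∑ᶠ v : PlaceOver K F, if v ≠ P ∧ v.degree = 1 then χ (Finsupp.single v 1) else 0 := by
  unfold placePowerSum
  refine finsum_congr fun v => ?_
  by_cases hv : v ≠ P ∧ v.degree = 1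
  · rw [if_pos ⟨hv.1, hv.2 ▸ dvd_refl _, one_ne_zero⟩, if_pos hv, hv.2]
    simp
  · rw [if_neg hv, if_neg]
    rintro ⟨h1, h2, -⟩
    exact hv ⟨h1, Nat.dvd_one.mp h2⟩

/-- **The Weil bound for a member of a family of nontrivial ray class characters** (the analytic
half of [KohelShparlinski2000, Thm. 1]: Prop. 1 = polynomiality, Prop. 2 = Riemann hypothesis fed
in as an orbit bound). Let `F/𝔽_q` be a function field with full constant field `𝔽_q`, `P` a place,
`N ≥ 1`, and `(χᵢ)_{i ∈ s}` finitely many characters of `Div(F)` each trivial on the divisors of the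
ray functions `h ≡ 1 (mod 𝔪_P^N)` and nontrivial on some divisor of degree `0` prime to `P`. If
`‖Σ_{i ∈ s} S_r(χᵢ)‖ ≤ C · q^{r/2}` for all `r ≥ 1`, then `‖S₁(χᵢ)‖ ≤ (2g - 2 + N deg P) √q` for
each `i ∈ s`. Proof: each `L(χᵢ, t)` is a polynomial of degree `≤ 2g - 2 + N deg P` with constant
term `1` and `t L' = L · Σ_r S_r t^r`; the orbit bound and the power-sum lemma give `‖z‖⁻¹ ≤ √q`
for every root `z` of every `L(χᵢ, t)`; and `S₁ = -Σ_z z⁻¹`.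
[cite: KohelShparlinski2000, Props. 1–2 and proof of Thm. 1 (p. 398)] -/
theorem norm_placePowerSum_one_le_of_family [Fintype K] [IsAlgFunctionField K F]
    [IsIntegrallyClosedIn K F] (P : PlaceOver K F) {N : ℕ} (hN : 1 ≤ N) {ι : Type*}
    (s : Finset ι) (χ : ι → AddChar (Divisor K F) ℂ)
    (hray : ∀ i ∈ s, ∀ h : F, h ∈ P.ray N → h ≠ 0 → χ i (principalDivisor K h) = 1)
    (hnt : ∀ i ∈ s, ∃ D₁ : Divisor K F, D₁ P = 0 ∧ D₁.degree = 0 ∧ χ i D₁ ≠ 1)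
    {C : ℝ}
    (hb : ∀ r : ℕ, 0 < r →
      ‖∑ i ∈ s, placePowerSum P (χ i) r‖ ≤ C * Real.sqrt (Fintype.card K) ^ r)
    {i : ι} (hi : i ∈ s) :
    ‖placePowerSum P (χ i) 1‖ ≤
      (2 * genus K F - 2 + N * P.degree : ℕ) * Real.sqrt (Fintype.card K) := by
  -- the `L`-polynomials of the family
  have hL : ∀ j ∈ s, ∃ L : Polynomial ℂ, L.natDegree ≤ 2 * genus K F - 2 + N * P.degree ∧
      (L : PowerSeries ℂ) = rayClassLSeries P (χ j) := by
    intro j hj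
    obtain ⟨D₁, hD₁P, hD₁d, hχD₁⟩ := hnt j hj
    exact AddChar.exists_polynomial_eq_rayClassLSeries hN (χ j) (hray j hj) hD₁P hD₁d hχD₁
  choose! L hLdeg hLeq using hL
  set S : ι → PowerSeries ℂ := fun j => PowerSeries.mk (placePowerSum P (χ j)) with hS
  -- constant terms `1`
  have h0 : ∀ j ∈ s, (L j).coeff 0 = 1 := by
    intro j hj
    have h := congrArg (PowerSeries.coeff 0) (hLeq j hj)
    rw [Polynomial.coeff_coe, coeff_rayClassLSeries, rayClassCoeff_zero, AddChar.map_zero_eq_one] at h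
    exact h
  -- Euler products `t L' = L S`
  have hE : ∀ j ∈ s, PowerSeries.X * PowerSeries.derivative ℂ (L j : PowerSeries ℂ) =
      (L j : PowerSeries ℂ) * S j := by
    intro j hj
    rw [hLeq j hj]
    exact X_mul_derivative_rayClassLSeries (χ j)
  -- the orbit bound on the coefficients of `Σ S j`
  set ρ : ℝ := Real.sqrt (Fintype.card K) with hρ
  have hρ0 : 0 < ρ := Real.sqrt_pos.mpr (by exact_mod_cast Fintype.card_pos)
  have hb' : ∀ r : ℕ, 0 < r → ‖PowerSeries.coeff r (∑ j ∈ s, S j)‖ ≤ C * ρ ^ r := by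
    intro r hr
    have : PowerSeries.coeff r (∑ j ∈ s, S j) = ∑ j ∈ s, placePowerSum P (χ j) r := by
      rw [map_sum]
      exact Finset.sum_congr rfl fun j _ => by rw [hS, PowerSeries.coeff_mk]
    rw [this]
    exact hb r hr
  -- roots of `L i` have `‖z‖⁻¹ ≤ √q`
  have hroots : ∀ z ∈ (L i).roots, ‖z‖⁻¹ ≤ ρ := fun z hz =>
    norm_inv_le_of_logDeriv_bound s L S h0 hE hρ0 C hb' hi hz
  -- `S₁ = coeff 1 (S i)`
  have h1 := norm_coeff_one_le_of_roots (h0 i hi) (hE i hi) hroots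
  rw [hS, PowerSeries.coeff_mk] at h1
  refine h1.trans ?_
  exact mul_le_mul_of_nonneg_right (by exact_mod_cast hLdeg i hi) hρ0.le

end Literature.NumberTheory.DiophantineGeometry.AlgFunctionField

/-! ### The Kohel–Shparlinski sums as place power sums of the elliptic function field -/

namespace Literature.NumberTheory.EllipticCurves.KohelShparlinski

open Literature.NumberTheory.DiophantineGeometry
open AlgFunctionField WeierstrassPlaceAtInfinity WeierstrassRationalPlaces

section Term

variable {k : Type} [Field k] [DecidableEq k]

/-- The summand of `S(ω, ψ, f)` at a point: `ω(P) ψ(f(P))` at an affine point, `0` at `O`.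
[cite: KohelShparlinski2000, §1 (definition of S)] -/
def affineTerm (W : WeierstrassCurve k) (ω : AddChar W.toAffine.Point ℂ) (ψ : AddChar k ℂ)
    (f : k → k → k) : W.toAffine.Point → ℂ
  | .zero => 0
  | .some (x := a) (y := b) h => ω (.some a b h) * ψ (f a b)

/-- `affineTerm` at `O`. [folklore] -/
@[simp]
theorem affineTerm_zero (W : WeierstrassCurve k) (ω : AddChar W.toAffine.Point ℂ) (ψ : AddChar k ℂ)
    (f : k → k → k) : affineTerm W ω ψ f 0 = 0 :=
  rfl

/-- `affineTerm` at an affine point. [folklore] -/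
@[simp]
theorem affineTerm_some (W : WeierstrassCurve k) (ω : AddChar W.toAffine.Point ℂ) (ψ : AddChar k ℂ)
    (f : k → k → k) {a b : k} (h : W.toAffine.Nonsingular a b) :
    affineTerm W ω ψ f (.some a b h) = ω (.some a b h) * ψ (f a b) :=
  rfl

/-- **`S₁(χ)` of the elliptic function field is a sum over the rational points**: for a character
`χ` of `Div(k(W))` and the place at infinity `∞`,
`S₁(χ) = Σ_{deg v = 1, v ≠ ∞} χ(v) = Σ_{P ∈ W(k), P ≠ O} χ(placeOfPoint P)` (the rational places of
`k(W)/k` are the places of the rational points, `pointEquivRatPlaces`, and `placeOfPoint O = ∞`).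
[cite: KohelShparlinski2000, §2 (S as the linear coefficient of the L-function)] -/
theorem placePowerSum_infPlace_one_eq_finsum (W : WeierstrassCurve k) [W.IsElliptic]
    (χ : AddChar (Divisor k W.toAffine.FunctionField) ℂ) :
    placePowerSum (infPlace W.toAffine) χ 1 =
      ∑ᶠ P : W.toAffine.Point,
        if P = 0 then 0 else χ (Finsupp.single (placeOfPoint W.toAffine P) 1) := by
  rw [placePowerSum_one]
  -- the summand is supported on the rational places, i.e. on the range of `placeOfPoint`
  set G : PlaceOver k W.toAffine.FunctionField → ℂ := fun v =>
    if v ≠ infPlace W.toAffine then χ (Finsupp.single v 1) else 0 with hG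
  have hind : ∀ v : PlaceOver k W.toAffine.FunctionField,
      (if v ≠ infPlace W.toAffine ∧ v.degree = 1 then χ (Finsupp.single v 1) else 0) =
        Set.indicator (Set.range (placeOfPoint W.toAffine)) G v := by
    intro v
    by_cases hv1 : v.degree = 1
    · obtain ⟨P, rfl⟩ := exists_placeOfPoint_eq (V := W.toAffine) hv1
      rw [Set.indicator_of_mem (Set.mem_range_self P), hG]
      by_cases hP : placeOfPoint W.toAffine P ≠ infPlace W.toAffine
      · rw [if_pos ⟨hP, hv1⟩]
        simp only [hP, ne_eq, not_false_eq_true, ↓reduceIte]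
      · rw [if_neg (fun h => hP h.1)]
        simp only [hP, ↓reduceIte]
    · rw [if_neg (fun h => hv1 h.2), Set.indicator_of_notMem]
      rintro ⟨P, rfl⟩
      exact hv1 (degree_placeOfPoint P)
  rw [finsum_congr hind, ← finsum_mem_def, finsum_mem_range (placeOfPoint_injective (V := W.toAffine))]
  refine finsum_congr fun P => ?_
  rw [hG]
  by_cases hP : P = 0
  · subst hP
    simp
  · have hne : placeOfPoint W.toAffine P ≠ infPlace W.toAffine := by
      rw [← placeOfPoint_zero (V := W.toAffine)]
      exact fun h => hP (placeOfPoint_injective h)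
    simp only [hne, ne_eq, not_false_eq_true, ↓reduceIte, hP]

end Term

section Points

variable {k : Type} [Field k] [Fintype k] [DecidableEq k]

/-- **`S(ω, ψ, f)` as a sum over Mathlib's points**: the `dite`-sum over `𝔽_q × 𝔽_q` of the named
fact equals `Σ_{P ∈ W(𝔽_q)} affineTerm P` (the affine points `(a, b)` are in bijection with the
points `P ≠ O`, at which `affineTerm` vanishes). [cite: KohelShparlinski2000, §1 (definition of S)] -/
theorem affineCharSum_top_eq_finsum (W : WeierstrassCurve k) (ω : AddChar W.toAffine.Point ℂ)
    (ψ : AddChar k ℂ) (f : k → k → k) :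
    affineCharSum W ⊤ ω ψ f = ∑ᶠ P : W.toAffine.Point, affineTerm W ω ψ f P := by
  haveI : Finite W.toAffine.Point := finite_affinePoint W
  letI : Fintype W.toAffine.Point := Fintype.ofFinite _
  -- the point of a pair, `O` off the curve
  set g : k × k → W.toAffine.Point := fun xy =>
    if h : W.toAffine.Nonsingular xy.1 xy.2 then .some xy.1 xy.2 h else 0 with hg
  have hterm : ∀ xy : k × k,
      (if h : W.toAffine.Nonsingular xy.1 xy.2 then
        ω (WeierstrassCurve.Affine.Point.some xy.1 xy.2 h) * ψ (f xy.1 xy.2) else 0) =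
      affineTerm W ω ψ f (g xy) := by
    intro xy
    by_cases h : W.toAffine.Nonsingular xy.1 xy.2
    · rw [dif_pos h, hg]
      simp only [h, ↓reduceDIte]
      rfl
    · rw [dif_neg h, hg]
      simp only [h, ↓reduceDIte]
      rfl
  rw [affineCharSum_top, Finset.sum_congr rfl fun xy _ => hterm xy]
  -- restrict to the nonsingular pairs, on which `g` is injective
  set s : Finset (k × k) := Finset.univ.filter fun xy => W.toAffine.Nonsingular xy.1 xy.2 with hs
  have hsum : ∑ xy : k × k, affineTerm W ω ψ f (g xy) = ∑ xy ∈ s, affineTerm W ω ψ f (g xy) := by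
    rw [hs, Finset.sum_filter]
    refine Finset.sum_congr rfl fun xy _ => ?_
    by_cases h : W.toAffine.Nonsingular xy.1 xy.2
    · rw [if_pos h]
    · rw [if_neg h, hg]
      simp only [h, ↓reduceDIte]
      rfl
  have hinj : Set.InjOn g s := by
    intro xy hxy xy' hxy' e
    rw [hs, Finset.coe_filter] at hxy hxy'
    rw [hg] at e
    simp only [hxy.2, hxy'.2, ↓reduceDIte, WeierstrassCurve.Affine.Point.some.injEq] at e
    exact Prod.ext e.1 e.2
  rw [hsum, ← Finset.sum_image hinj]
  symm
  refine finsum_eq_sum_of_support_subset _ fun P hP => ?_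
  rw [Function.mem_support] at hP
  rcases P with _ | ⟨a, b, h⟩
  · exact absurd rfl hP
  · rw [Finset.coe_image]
    refine ⟨(a, b), ?_, ?_⟩
    · rw [hs, Finset.coe_filter]
      exact ⟨Finset.mem_univ _, h⟩
    · rw [hg]
      simp only [h, ↓reduceDIte]

/-- If `χ(placeOfPoint (a, b)) = ω((a, b)) ψ(f a b)` at every affine point, then
`S₁(χ) = S(ω, ψ, f)`. [cite: KohelShparlinski2000, §2] -/
theorem placePowerSum_infPlace_one_eq_affineCharSum (W : WeierstrassCurve k) [W.IsElliptic]
    (ω : AddChar W.toAffine.Point ℂ) (ψ : AddChar k ℂ) (f : k → k → k)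
    (χ : AddChar (Divisor k W.toAffine.FunctionField) ℂ)
    (hval : ∀ {a b : k} (h : W.toAffine.Nonsingular a b),
      χ (Finsupp.single (placeOfPoint W.toAffine (.some a b h)) 1) = ω (.some a b h) * ψ (f a b)) :
    placePowerSum (infPlace W.toAffine) χ 1 = affineCharSum W ⊤ ω ψ f := by
  rw [placePowerSum_infPlace_one_eq_finsum, affineCharSum_top_eq_finsum]
  refine finsum_congr fun P => ?_
  rcases P with _ | ⟨a, b, h⟩
  · exact if_pos rfl
  · rw [if_neg (WeierstrassCurve.Affine.Point.some_ne_zero h), affineTerm_some, hval h]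

/-! ### The reduction of the named fact to ray class families -/

/-- **`|S(ω, ψ, f)| ≤ N √q` from a ray class family modulo `N·∞`** ([KohelShparlinski2000, Thm. 1]
for the elliptic function field, where `2g - 2 + N deg ∞ = N`): if `χ` lies in a finite family `s`
of characters of `Div(𝔽_q(W))`, each trivial on the divisors of the functions
`h ≡ 1 (mod 𝔪_∞^N)` and nontrivial on some divisor of degree `0` prime to `∞`, the family satisfies
`‖Σ_{χ' ∈ s} S_r(χ')‖ ≤ C q^{r/2}` (`r ≥ 1`), and `χ(placeOfPoint (a, b)) = ω((a, b)) ψ(f a b)` at the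
affine points, then `|S(ω, ψ, f)| ≤ N √q`. [cite: KohelShparlinski2000, Thm. 1 and (3)] -/
theorem norm_affineCharSum_le_of_family (W : WeierstrassCurve k) [W.IsElliptic]
    (ω : AddChar W.toAffine.Point ℂ) (ψ : AddChar k ℂ) (f : k → k → k) {N : ℕ} (hN : 1 ≤ N)
    (s : Finset (AddChar (Divisor k W.toAffine.FunctionField) ℂ))
    {χ : AddChar (Divisor k W.toAffine.FunctionField) ℂ} (hχ : χ ∈ s)
    (hval : ∀ {a b : k} (h : W.toAffine.Nonsingular a b),
      χ (Finsupp.single (placeOfPoint W.toAffine (.some a b h)) 1) = ω (.some a b h) * ψ (f a b))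
    (hray : ∀ χ' ∈ s, ∀ h : W.toAffine.FunctionField, h ∈ (infPlace W.toAffine).ray N → h ≠ 0 →
      χ' (principalDivisor k h) = 1)
    (hnt : ∀ χ' ∈ s, ∃ D₁ : Divisor k W.toAffine.FunctionField,
      D₁ (infPlace W.toAffine) = 0 ∧ D₁.degree = 0 ∧ χ' D₁ ≠ 1)
    {C : ℝ}
    (hb : ∀ r : ℕ, 0 < r →
      ‖∑ χ' ∈ s, placePowerSum (infPlace W.toAffine) χ' r‖ ≤ C * Real.sqrt (Fintype.card k) ^ r) :
    ‖affineCharSum W ⊤ ω ψ f‖ ≤ N * Real.sqrt (Fintype.card k) := by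
  have h := norm_placePowerSum_one_le_of_family (infPlace W.toAffine) hN s
    (fun χ' : AddChar (Divisor k W.toAffine.FunctionField) ℂ => χ') hray hnt hb hχ
  rw [placePowerSum_infPlace_one_eq_affineCharSum W ω ψ f χ hval,
    WeierstrassGenus.genus_eq_one W.toAffine, degree_infPlace] at h
  simpa using h

/-- **The named fact from ray class families** ([KohelShparlinski2000, Thm. 1 with
`𝔣 = 3·O` for `f = x`, `p ≠ 2`, and `𝔣 = 4·O` for `f = y`, `p ≠ 3`], then (3) and Cor. 1). Suppose
that for every finite field `k`, every elliptic curve `W/k`, every character `ω` of `W(k)` and every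
nontrivial additive character `ψ`:
(x) if `p ≠ 2`, some finite family of characters of `Div(k(W))` — each trivial on the divisors of the
functions `h ≡ 1 (mod 𝔪_∞³)`, each nontrivial on a divisor of degree `0` prime to `∞`, with the orbit
bound `‖Σ S_r‖ ≤ C q^{r/2}` — contains a `χ` with `χ(placeOfPoint (a, b)) = ω((a, b)) ψ(a)`;
(y) if `p ≠ 3`, the same modulo `𝔪_∞⁴` with `χ(placeOfPoint (a, b)) = ω((a, b)) ψ(b)`.
Then `CoordinateCharSumBound` holds: `|S(ω, ψ, x)| ≤ 3√q ≤ 4√q`, `|S(ω, ψ, y)| ≤ 4√q ≤ 6√q`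
(`norm_affineCharSum_le_of_family`), and the subgroup sums follow by averaging
(`coordinateCharSumBound_of_top`). [cite: KohelShparlinski2000, Thm. 1, (3) and Cor. 1 (pp. 398–399)] -/
theorem coordinateCharSumBound_of_families
    (hx : ∀ {k : Type} [Field k] [Fintype k] [DecidableEq k] (W : WeierstrassCurve k) [W.IsElliptic]
      (ω : AddChar W.toAffine.Point ℂ) (ψ : AddChar k ℂ), ψ ≠ 0 → ringChar k ≠ 2 →
      ∃ (s : Finset (AddChar (Divisor k W.toAffine.FunctionField) ℂ))
        (χ : AddChar (Divisor k W.toAffine.FunctionField) ℂ), χ ∈ s ∧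
        (∀ {a b : k} (h : W.toAffine.Nonsingular a b),
          χ (Finsupp.single (placeOfPoint W.toAffine (.some a b h)) 1) = ω (.some a b h) * ψ a) ∧
        (∀ χ' ∈ s, ∀ h : W.toAffine.FunctionField, h ∈ (infPlace W.toAffine).ray 3 → h ≠ 0 →
          χ' (principalDivisor k h) = 1) ∧
        (∀ χ' ∈ s, ∃ D₁ : Divisor k W.toAffine.FunctionField,
          D₁ (infPlace W.toAffine) = 0 ∧ D₁.degree = 0 ∧ χ' D₁ ≠ 1) ∧
        ∃ C : ℝ, ∀ r : ℕ, 0 < r →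
          ‖∑ χ' ∈ s, placePowerSum (infPlace W.toAffine) χ' r‖ ≤
            C * Real.sqrt (Fintype.card k) ^ r)
    (hy : ∀ {k : Type} [Field k] [Fintype k] [DecidableEq k] (W : WeierstrassCurve k) [W.IsElliptic]
      (ω : AddChar W.toAffine.Point ℂ) (ψ : AddChar k ℂ), ψ ≠ 0 → ringChar k ≠ 3 →
      ∃ (s : Finset (AddChar (Divisor k W.toAffine.FunctionField) ℂ))
        (χ : AddChar (Divisor k W.toAffine.FunctionField) ℂ), χ ∈ s ∧
        (∀ {a b : k} (h : W.toAffine.Nonsingular a b),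
          χ (Finsupp.single (placeOfPoint W.toAffine (.some a b h)) 1) = ω (.some a b h) * ψ b) ∧
        (∀ χ' ∈ s, ∀ h : W.toAffine.FunctionField, h ∈ (infPlace W.toAffine).ray 4 → h ≠ 0 →
          χ' (principalDivisor k h) = 1) ∧
        (∀ χ' ∈ s, ∃ D₁ : Divisor k W.toAffine.FunctionField,
          D₁ (infPlace W.toAffine) = 0 ∧ D₁.degree = 0 ∧ χ' D₁ ≠ 1) ∧
        ∃ C : ℝ, ∀ r : ℕ, 0 < r →
          ‖∑ χ' ∈ s, placePowerSum (infPlace W.toAffine) χ' r‖ ≤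
            C * Real.sqrt (Fintype.card k) ^ r) :
    CoordinateCharSumBound := by
  refine coordinateCharSumBound_of_top ?_
  intro k _ _ _ W _ ω ψ hψ
  refine ⟨fun hp => ?_, fun hp => ?_⟩
  · obtain ⟨s, χ, hχ, hval, hray, hnt, C, hb⟩ := hx W ω ψ hψ hp
    have h := norm_affineCharSum_le_of_family W ω ψ (fun a _ => a) (by norm_num : 1 ≤ 3) s hχ
      hval hray hnt hb
    refine h.trans ?_
    have hq : 0 ≤ Real.sqrt (Fintype.card k) := Real.sqrt_nonneg _
    push_cast
    nlinarith
  · obtain ⟨s, χ, hχ, hval, hray, hnt, C, hb⟩ := hy W ω ψ hψ hp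
    have h := norm_affineCharSum_le_of_family W ω ψ (fun _ b => b) (by norm_num : 1 ≤ 4) s hχ
      hval hray hnt hb
    refine h.trans ?_
    have hq : 0 ≤ Real.sqrt (Fintype.card k) := Real.sqrt_nonneg _
    push_cast
    nlinarith

end Points

/-! ### Appended: the trivial bound, indexed families, and the small-group escape -/

section Indexed

variable {k : Type} [Field k] [Fintype k] [DecidableEq k]

/-- **The trivial bound** `|S(ω, ψ, f)| ≤ #W(𝔽_q) - 1`: every affine point contributes a term of
modulus `1` (`|ω(P)| = |ψ(·)| = 1`) and `O` contributes nothing.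
[cite: KohelShparlinski2000, §1 (definition of S)] -/
theorem norm_affineCharSum_le_card_sub_one (W : WeierstrassCurve k) (ω : AddChar W.toAffine.Point ℂ)
    (ψ : AddChar k ℂ) (f : k → k → k) :
    ‖affineCharSum W ⊤ ω ψ f‖ ≤ (Nat.card W.toAffine.Point : ℝ) - 1 := by
  haveI : Finite W.toAffine.Point := finite_affinePoint W
  letI : Fintype W.toAffine.Point := Fintype.ofFinite _
  rw [affineCharSum_top_eq_finsum, finsum_eq_sum_of_fintype, Nat.card_eq_fintype_card]
  have hterm : ∀ P : W.toAffine.Point, ‖affineTerm W ω ψ f P‖ ≤ if P = 0 then 0 else 1 := by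
    rintro (_ | ⟨a, b, h⟩)
    · show ‖affineTerm W ω ψ f 0‖ ≤ if (0 : W.toAffine.Point) = 0 then 0 else 1
      rw [if_pos rfl, affineTerm_zero, norm_zero]
    · rw [if_neg (WeierstrassCurve.Affine.Point.some_ne_zero h), affineTerm_some, norm_mul,
        AddChar.norm_apply, AddChar.norm_apply, one_mul]
  calc ‖∑ P : W.toAffine.Point, affineTerm W ω ψ f P‖
      ≤ ∑ P : W.toAffine.Point, ‖affineTerm W ω ψ f P‖ := norm_sum_le _ _
    _ ≤ ∑ P : W.toAffine.Point, (if P = 0 then (0 : ℝ) else 1) := Finset.sum_le_sum fun P _ => hterm P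
    _ = (Fintype.card W.toAffine.Point : ℝ) - 1 := by
        rw [Finset.sum_ite, Finset.sum_const_zero, zero_add, Finset.sum_const, nsmul_eq_mul, mul_one,
          Finset.filter_ne' Finset.univ (0 : W.toAffine.Point), Finset.card_erase_of_mem (Finset.mem_univ _),
          Finset.card_univ, Nat.cast_sub Fintype.card_pos, Nat.cast_one]

/-- If `W(𝔽_q)` has no three distinct points then `|S(ω, ψ, f)| ≤ 1`. [folklore] -/
theorem norm_affineCharSum_le_one_of_not_three (W : WeierstrassCurve k) (ω : AddChar W.toAffine.Point ℂ)
    (ψ : AddChar k ℂ) (f : k → k → k)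
    (h3 : ¬ ∃ P₁ P₂ P₃ : W.toAffine.Point, P₁ ≠ P₂ ∧ P₁ ≠ P₃ ∧ P₂ ≠ P₃) :
    ‖affineCharSum W ⊤ ω ψ f‖ ≤ 1 := by
  haveI : Finite W.toAffine.Point := finite_affinePoint W
  letI : Fintype W.toAffine.Point := Fintype.ofFinite _
  have hcard : Fintype.card W.toAffine.Point ≤ 2 := by
    by_contra hlt
    exact h3 (Fintype.two_lt_card_iff.1 (by omega))
  refine (norm_affineCharSum_le_card_sub_one W ω ψ f).trans ?_
  rw [Nat.card_eq_fintype_card]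
  have : (Fintype.card W.toAffine.Point : ℝ) ≤ 2 := by exact_mod_cast hcard
  linarith

/-- **`|S(ω, ψ, f)| ≤ N √q` from an INDEXED ray class family modulo `N·∞`** (as
`norm_affineCharSum_le_of_family`, for a family `χ : ι → Hom(Div, ℂ*)` over a finite index set,
possibly with repetitions). [cite: KohelShparlinski2000, Thm. 1 and (3)] -/
theorem norm_affineCharSum_le_of_indexedFamily (W : WeierstrassCurve k) [W.IsElliptic]
    (ω : AddChar W.toAffine.Point ℂ) (ψ : AddChar k ℂ) (f : k → k → k) {N : ℕ} (hN : 1 ≤ N)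
    {ι : Type*} (s : Finset ι) (χ : ι → AddChar (Divisor k W.toAffine.FunctionField) ℂ)
    {i : ι} (hi : i ∈ s)
    (hval : ∀ {a b : k} (h : W.toAffine.Nonsingular a b),
      χ i (Finsupp.single (placeOfPoint W.toAffine (.some a b h)) 1) = ω (.some a b h) * ψ (f a b))
    (hray : ∀ j ∈ s, ∀ h : W.toAffine.FunctionField, h ∈ (infPlace W.toAffine).ray N → h ≠ 0 →
      χ j (principalDivisor k h) = 1)
    (hnt : ∀ j ∈ s, ∃ D₁ : Divisor k W.toAffine.FunctionField,
      D₁ (infPlace W.toAffine) = 0 ∧ D₁.degree = 0 ∧ χ j D₁ ≠ 1)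
    {C : ℝ}
    (hb : ∀ r : ℕ, 0 < r →
      ‖∑ j ∈ s, placePowerSum (infPlace W.toAffine) (χ j) r‖ ≤ C * Real.sqrt (Fintype.card k) ^ r) :
    ‖affineCharSum W ⊤ ω ψ f‖ ≤ N * Real.sqrt (Fintype.card k) := by
  have h := norm_placePowerSum_one_le_of_family (infPlace W.toAffine) hN s χ hray hnt hb hi
  rw [placePowerSum_infPlace_one_eq_affineCharSum W ω ψ f (χ i) hval,
    WeierstrassGenus.genus_eq_one W.toAffine, degree_infPlace] at h
  simpa using h

/-- **The named fact from indexed ray class families, needed only for `#W(𝔽_q) ≥ 3`**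
(refinement of `coordinateCharSumBound_of_families`): the family for `f = x` (`p ≠ 2`, modulus `3·∞`)
resp. `f = y` (`p ≠ 3`, modulus `4·∞`) may be produced under the extra hypothesis that `W(𝔽_q)` has
three distinct points; when it has at most two, `|S| ≤ 1 ≤ 4√q` trivially
(`norm_affineCharSum_le_one_of_not_three`). [cite: KohelShparlinski2000, Thm. 1, (3) and Cor. 1 (pp. 398–399)] -/
theorem coordinateCharSumBound_of_indexedFamilies
    (hx : ∀ {k : Type} [Field k] [Fintype k] [DecidableEq k] (W : WeierstrassCurve k) [W.IsElliptic]
      (ω : AddChar W.toAffine.Point ℂ) (ψ : AddChar k ℂ), ψ ≠ 0 → ringChar k ≠ 2 →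
      (∃ P₁ P₂ P₃ : W.toAffine.Point, P₁ ≠ P₂ ∧ P₁ ≠ P₃ ∧ P₂ ≠ P₃) →
      ∃ (ι : Type) (s : Finset ι) (χ : ι → AddChar (Divisor k W.toAffine.FunctionField) ℂ) (i : ι),
        i ∈ s ∧
        (∀ {a b : k} (h : W.toAffine.Nonsingular a b),
          χ i (Finsupp.single (placeOfPoint W.toAffine (.some a b h)) 1) = ω (.some a b h) * ψ a) ∧
        (∀ j ∈ s, ∀ h : W.toAffine.FunctionField, h ∈ (infPlace W.toAffine).ray 3 → h ≠ 0 →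
          χ j (principalDivisor k h) = 1) ∧
        (∀ j ∈ s, ∃ D₁ : Divisor k W.toAffine.FunctionField,
          D₁ (infPlace W.toAffine) = 0 ∧ D₁.degree = 0 ∧ χ j D₁ ≠ 1) ∧
        ∃ C : ℝ, ∀ r : ℕ, 0 < r →
          ‖∑ j ∈ s, placePowerSum (infPlace W.toAffine) (χ j) r‖ ≤
            C * Real.sqrt (Fintype.card k) ^ r)
    (hy : ∀ {k : Type} [Field k] [Fintype k] [DecidableEq k] (W : WeierstrassCurve k) [W.IsElliptic]
      (ω : AddChar W.toAffine.Point ℂ) (ψ : AddChar k ℂ), ψ ≠ 0 → ringChar k ≠ 3 →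
      (∃ P₁ P₂ P₃ : W.toAffine.Point, P₁ ≠ P₂ ∧ P₁ ≠ P₃ ∧ P₂ ≠ P₃) →
      ∃ (ι : Type) (s : Finset ι) (χ : ι → AddChar (Divisor k W.toAffine.FunctionField) ℂ) (i : ι),
        i ∈ s ∧
        (∀ {a b : k} (h : W.toAffine.Nonsingular a b),
          χ i (Finsupp.single (placeOfPoint W.toAffine (.some a b h)) 1) = ω (.some a b h) * ψ b) ∧
        (∀ j ∈ s, ∀ h : W.toAffine.FunctionField, h ∈ (infPlace W.toAffine).ray 4 → h ≠ 0 →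
          χ j (principalDivisor k h) = 1) ∧
        (∀ j ∈ s, ∃ D₁ : Divisor k W.toAffine.FunctionField,
          D₁ (infPlace W.toAffine) = 0 ∧ D₁.degree = 0 ∧ χ j D₁ ≠ 1) ∧
        ∃ C : ℝ, ∀ r : ℕ, 0 < r →
          ‖∑ j ∈ s, placePowerSum (infPlace W.toAffine) (χ j) r‖ ≤
            C * Real.sqrt (Fintype.card k) ^ r) :
    CoordinateCharSumBound := by
  refine coordinateCharSumBound_of_top ?_
  intro k _ _ _ W _ ω ψ hψ
  have hq1 : (1 : ℝ) ≤ Real.sqrt (Fintype.card k) := by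
    rw [Real.one_le_sqrt]
    exact_mod_cast Fintype.card_pos
  refine ⟨fun hp => ?_, fun hp => ?_⟩
  · by_cases h3 : ∃ P₁ P₂ P₃ : W.toAffine.Point, P₁ ≠ P₂ ∧ P₁ ≠ P₃ ∧ P₂ ≠ P₃
    · obtain ⟨ι, s, χ, i, hi, hval, hray, hnt, C, hb⟩ := hx W ω ψ hψ hp h3
      have h := norm_affineCharSum_le_of_indexedFamily W ω ψ (fun a _ => a) (by norm_num : 1 ≤ 3) s χ
        hi hval hray hnt hb
      refine h.trans ?_
      push_cast
      nlinarith
    · exact (norm_affineCharSum_le_one_of_not_three W ω ψ _ h3).trans (by nlinarith)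
  · by_cases h3 : ∃ P₁ P₂ P₃ : W.toAffine.Point, P₁ ≠ P₂ ∧ P₁ ≠ P₃ ∧ P₂ ≠ P₃
    · obtain ⟨ι, s, χ, i, hi, hval, hray, hnt, C, hb⟩ := hy W ω ψ hψ hp h3
      have h := norm_affineCharSum_le_of_indexedFamily W ω ψ (fun _ b => b) (by norm_num : 1 ≤ 4) s χ
        hi hval hray hnt hb
      refine h.trans ?_
      push_cast
      nlinarith
    · exact (norm_affineCharSum_le_one_of_not_three W ω ψ _ h3).trans (by nlinarith)

end Indexed

end Literature.NumberTheory.EllipticCurves.KohelShparlinski
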